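import Literature.Topology.FourManifolds.StellarMoves
import Literature.Topology.FourManifolds.ComplexLinkStar
import Literature.Topology.FourManifolds.SmoothTriangulation
import Literature.Analysis.Convexity.SimplexTriangulationPure
import HarnessLib

/-!
# Stellar theory: PL homeomorphism of complexes and the classical theorems (named facts)

Topic `Literature/Topology/FourManifolds`; definition request `defn-StellarMoves` (D1 of route
`SmoothPoincare4/LogCYSkeleton`), part 3: the notion of PL homeomorphism of finite geometric
simplicial complexes and the classical theorems of combinatorial topology connecting it with the
stellar moves of `StellarMoves.lean` — stated as NAMED FACTS (D-0014: `def … : Prop`, cited,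
unproved; users take `(h : <Fact>)`), plus the definitional bridges between the abstract toolkit
(`Faces.…` on `K.faces`) and the geometric subcomplexes of `ComplexLinkStar.lean`.

* `PLHomeomorphicCx K L` — **PL homeomorphic complexes**: `K` and `L` have finite subdivisions that
  are simplicially isomorphic [Lickorish1999, §2 and Def. 4.1]; "combinatorially equivalent,
  `K ≈ L`" (Datta 2007, §1).  Equivalent (Rourke–Sanderson) to the existence of a homeomorphism
  `|K| → |L|` affine on every simplex of a subdivision of `K`; for compact polyhedra in `ℝᵈ` the
  tree's map-level notion is `Literature.Barriers.KontsevichZagierPeriods.PL.PLHomeomorphic`.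
* The two named facts the route asked for (both for FINITE complexes):
  - `Lickorish1999_thm_4_5` (Alexander 1930, Newman 1926; [Lickorish1999, Thm. 4.5]): *finite
    simplicial complexes are PL homeomorphic iff they are stellar equivalent*;
  - `Munkres1966_8_4_links_of_smoothTriangulation` ([Munkres1966, §8, Exercise (a) after
    Thm. 8.4]; Whitehead 1940): a Whitehead smooth triangulation of a boundaryless smooth
    `n`-manifold is a combinatorial `n`-manifold — the link of every `k`-simplex is a combinatorial
    `(n-k-1)`-sphere; with the proved corollary `isClosedCombinatorialManifold_of_isSmoothTriangulation`.
* PROVED: **a simplicial isomorphism of finite complexes induces a homeomorphism of polyhedra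
  affine on every simplex** (`Faces.Isomorphic.exists_homeomorph_affine`: the simplexwise affine
  extension `Literature.Analysis.Convexity.plMap` of the vertex bijection is a continuous bijection
  of the compact polyhedra — injective because an affine map with affinely independent vertex
  images is injective on the affine span and two closed simplices meet in their common face), hence
  **PL homeomorphic finite complexes have homeomorphic polyhedra** (`PLHomeomorphicCx.nonempty_homeomorph`)
  — the map reading "a homeomorphism `|K| → |L|` affine on each simplex of a subdivision of `K`"
  asked for by the route.
* Bridges (`rfl`): `antistarCx_faces_eq`, `closedStarCx_faces_eq`, `linkCx_faces_eq`; the route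
  clause `IsFaceCollapsible {s ∈ K.faces | v ∉ s}` of `SkeletonCertificate` is thus literally about
  `Faces.antistar K.faces v = (antistarCx K v).faces`.

## On the antistar of a vertex (what the route's recognition step needs, and what is NOT minted)

`CertificateRecognition` wants: *for a closed combinatorial `n`-manifold `M` and a vertex `v`, the
antistar `ast(v) = {s ∈ M | v ∉ s}` is a combinatorial `n`-manifold (with boundary `lk(v)`)*.  No
source read for this file prints that sentence, so it is not vendored (no fact without a proving
source).  Its classical derivation, every step of which IS printed and can be vendored on request
(typed against `StellarMoves.lean` verbatim): for a vertex `u` of `ast(v)`, `lk(u, ast v) =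
lk(u, M)` if `uv ∉ M`, and `= ast(v)` taken inside the sphere `S = lk(u, M)` otherwise; links of
simplices in combinatorial manifolds are balls or spheres and stellar moves preserve manifolds
[Lickorish1999, Lemma 3.2]; `st(v, S) = v ⋆ lk(v, S)` is a ball by the join formulae
`Bᵐ ⋆ Sⁿ ∼ Bᵐ⁺ⁿ⁺¹` etc. [Lickorish1999, §3, exercise after Def. 3.1; Datta 2007, Prop. 1.7];
Newman's theorem [Lickorish1999, Thm. 3.8] makes the closure of `S ∖ st(v, S)`
(`Faces.downClosure (S \ Faces.closedStar S {v})`) a ball; identifying that closure with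
`Faces.antistar S v` uses that a combinatorial sphere is a closed pseudomanifold — Datta 2007, §1.
Pachner's theorem *closed combinatorial `n`-manifolds are PL homeomorphic iff bistellar equivalent*
[Lickorish1999, Thm. 5.9] is likewise printed and typable as `Faces.StellarEquivalent M M' ↔
Faces.BistellarEquivalent M M'` for finite closed combinatorial manifolds on an infinite vertex type;
it has no consumer yet and is not minted.  Deliberately also NOT here: Datta's Prop. 1.6 (`|K|` is a
PL `n`-manifold iff all vertex links are `(n-1)`-spheres or balls), which needs the polyhedral
PL-manifold vocabulary of `LinearQuotientPL.lean`; the tree's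
`Whitehead1939_collapsible_PLManifold_PLBall` and `Lange2016_union_PLBalls_PLSphere`
(`WhiteheadCollapsibleBall.lean`) are the remaining facts of the recognition chain and are not
restated; and the second half of Whitehead's theorem — the PL structure of `M` generated by the
star charts of a smooth triangulation is Whitehead-compatible with the smooth structure
(`IsWhiteheadCompatible`, `PLManifold.lean`; Whitehead 1940, Munkres 1966 §10) — which needs PL
charts built from a combinatorial-manifold triangulation and is left to the recognition provers.

## References

* W. B. R. Lickorish, *Simplicial moves on complexes and manifolds*, Geom. Topol. Monogr. 2 (1999)
  299–320 = arXiv:math/9911256 (read): §2, Def. 2.2, §3 (exercise after Def. 3.1, Lemma 3.2,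
  Thm. 3.8), Def. 4.1, Thm. 4.5, Thm. 5.9. [Lickorish1999]
* B. Datta, *Minimal triangulations of manifolds*, J. Indian Inst. Sci. 87 (2007) 429–449 =
  arXiv:math/0701735 (read): §1, Prop. 1.5–1.7, Thm. 4.13–4.14. [Datta2007]
* J. R. Munkres, *Elementary differential topology*, Ann. of Math. Studies 54 (1963; rev. 1966),
  Thm. 8.4 and Exercise (a) following it (read in the 1963 printing). [Munkres1966]
* J. H. C. Whitehead, *On C¹-complexes*, Ann. of Math. 41 (1940) 809–824. [Whitehead1940]
* J. W. Alexander (1930) [Alexander1930]; M. H. A. Newman (1926) [Newman1926]; U. Pachner (1991)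
  [Pachner1991].
-/

open Set
open scoped Manifold ContDiff

noncomputable section

namespace Literature.Topology.FourManifolds

open Literature.Geometry.DiscreteGeometry (simplexBoundary)

/-! ### Bridges between the abstract toolkit and the geometric subcomplexes -/

section Bridges

variable {𝕜 E : Type*} [Ring 𝕜] [PartialOrder 𝕜] [AddCommGroup E] [Module 𝕜 E]

/-- The faces of the geometric antistar are the abstract antistar of the faces (definitional).
[folklore] -/
theorem antistarCx_faces_eq (K : Geometry.SimplicialComplex 𝕜 E) (v : E) :
    (antistarCx K v).faces = Faces.antistar K.faces v := rfl

/-- The vertex set of the faces of a geometric complex is its set of vertices. [folklore] -/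
theorem vertexSet_faces_eq_vertices (K : Geometry.SimplicialComplex 𝕜 E) :
    Faces.vertexSet K.faces = K.vertices := by
  ext v
  rw [Faces.mem_vertexSet_iff_singleton_mem K.isRelLowerSet_faces]
  rfl

variable [DecidableEq E]

/-- The faces of the geometric closed star are the abstract closed star (definitional). [folklore] -/
theorem closedStarCx_faces_eq (K : Geometry.SimplicialComplex 𝕜 E) (A : Finset E) :
    (closedStarCx K A).faces = Faces.closedStar K.faces A := rfl

/-- The faces of the geometric link are the abstract link (definitional). [folklore] -/
theorem linkCx_faces_eq (K : Geometry.SimplicialComplex 𝕜 E) (A : Finset E) :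
    (linkCx K A).faces = Faces.link K.faces A := rfl

end Bridges

/-! ### PL homeomorphic complexes -/

section PL

variable {𝕜 E E' : Type*} [Ring 𝕜] [PartialOrder 𝕜] [AddCommGroup E] [Module 𝕜 E]
  [AddCommGroup E'] [Module 𝕜 E']

/-- **PL homeomorphic complexes.** The geometric simplicial complexes `K ⊆ E` and `L ⊆ E'` are
*piecewise linearly homeomorphic* if they have FINITE subdivisions `K'`, `L'` (`IsSubdivision`)
that are simplicially isomorphic (`Faces.Isomorphic K'.faces L'.faces`: a bijection of vertices
inducing a bijection of simplices) — "Two simplicial complexes `K` and `L` are piecewise linearly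
homeomorphic if they have subdivisions `K′` and `L′` that are simplicially isomorphic"
[cite: Lickorish1999, §2 (piecewise linearly homeomorphic) and Def. 4.1]; Datta (2007), §1 ("combinatorially
equivalent", `K ≈ L`, "so `K ≈ L` iff `|K|` and `|L|` are pl homeomorphic").  Finiteness of the
subdivisions is Lickorish's standing assumption (Def. 2.1). -/
def PLHomeomorphicCx (K : Geometry.SimplicialComplex 𝕜 E) (L : Geometry.SimplicialComplex 𝕜 E') : Prop :=
  ∃ (K' : Geometry.SimplicialComplex 𝕜 E) (L' : Geometry.SimplicialComplex 𝕜 E'),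
    K'.faces.Finite ∧ L'.faces.Finite ∧ IsSubdivision K K' ∧ IsSubdivision L L' ∧
      Faces.Isomorphic K'.faces L'.faces

/-- A finite complex is PL homeomorphic to itself. [folklore] -/
theorem PLHomeomorphicCx.refl {K : Geometry.SimplicialComplex 𝕜 E} (hK : K.faces.Finite) :
    PLHomeomorphicCx K K :=
  ⟨K, K, hK, hK, IsSubdivision.refl K, IsSubdivision.refl K, Faces.Isomorphic.refl _⟩

/-- PL homeomorphy of complexes is symmetric. [folklore] -/
theorem PLHomeomorphicCx.symm {K : Geometry.SimplicialComplex 𝕜 E} {L : Geometry.SimplicialComplex 𝕜 E'}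
    (h : PLHomeomorphicCx K L) : PLHomeomorphicCx L K := by
  obtain ⟨K', L', hK', hL', hKK', hLL', hiso⟩ := h
  exact ⟨L', K', hL', hK', hLL', hKK', hiso.symm⟩

/-- Simplicially isomorphic finite complexes are PL homeomorphic. [folklore] -/
theorem PLHomeomorphicCx.of_isomorphic {K : Geometry.SimplicialComplex 𝕜 E}
    {L : Geometry.SimplicialComplex 𝕜 E'} (hK : K.faces.Finite) (hL : L.faces.Finite)
    (h : Faces.Isomorphic K.faces L.faces) : PLHomeomorphicCx K L :=
  ⟨K, L, hK, hL, IsSubdivision.refl K, IsSubdivision.refl L, h⟩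

/-- PL homeomorphic complexes along a subdivision of the first. [folklore] -/
theorem PLHomeomorphicCx.of_isSubdivision_left {K K₁ : Geometry.SimplicialComplex 𝕜 E}
    {L : Geometry.SimplicialComplex 𝕜 E'} (h₁ : IsSubdivision K K₁) (h : PLHomeomorphicCx K₁ L) :
    PLHomeomorphicCx K L := by
  obtain ⟨K', L', hK', hL', hKK', hLL', hiso⟩ := h
  exact ⟨K', L', hK', hL', h₁.trans hKK', hLL', hiso⟩

end PL

/-! ### Isomorphic finite complexes have homeomorphic polyhedra (the map reading of PL homeomorphy) -/

section IsoHomeo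

open Literature.Analysis.Convexity

variable {W V : Type*} [NormedAddCommGroup W] [NormedSpace ℝ W] [FiniteDimensional ℝ W]
  [NormedAddCommGroup V] [NormedSpace ℝ V]

/-- **A simplicial isomorphism of finite complexes induces a homeomorphism of polyhedra, affine on
every simplex**: if `K ⊆ W` (finite, `W` finite-dimensional) and `L ⊆ V` have isomorphic face
families, the simplexwise affine extension of the vertex bijection (`plMap`) restricts to a
homeomorphism `|K| ≃ₜ |L|` which agrees with an affine map on each closed simplex of `K`.  This is
the map form of "piecewise linearly homeomorphic" (a homeomorphism affine on the simplices of a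
subdivision), here for the subdivision `K` itself. [folklore] -/
theorem Faces.Isomorphic.exists_homeomorph_affine {K : Geometry.SimplicialComplex ℝ W}
    {L : Geometry.SimplicialComplex ℝ V} (hK : K.faces.Finite) (h : Faces.Isomorphic K.faces L.faces) :
    ∃ f : W → V, (∀ s ∈ K.faces, ∃ A : W →ᵃ[ℝ] V, EqOn f A (convexHull ℝ (s : Set W))) ∧
      ∃ e : K.space ≃ₜ L.space, ∀ x : K.space, (e x : V) = f x := by
  classical
  obtain ⟨e, he⟩ := h
  -- the vertex map, extended by `0`
  set g : W → V := fun x => if hx : x ∈ Faces.vertexSet K.faces then (e ⟨x, hx⟩ : V) else 0 with hg_def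
  have hg : ∀ x (hx : x ∈ Faces.vertexSet K.faces), g x = e ⟨x, hx⟩ := fun x hx => dif_pos hx
  have hgi : InjOn g (Faces.vertexSet K.faces) := fun x hx y hy hxy => by
    rw [hg x hx, hg y hy] at hxy
    exact congrArg Subtype.val (e.injective (Subtype.val_injective hxy))
  -- images of faces are faces, and every face of `L` is such an image
  have himg : ∀ s ∈ K.faces, ((s.image g : Finset V) : Set V) =
      Subtype.val '' (e '' {x : Faces.vertexSet K.faces | (x : W) ∈ s}) := fun s hs => by
    rw [Finset.coe_image, Set.image_image]
    ext y
    constructor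
    · rintro ⟨x, hx, rfl⟩
      exact ⟨⟨x, Faces.subset_vertexSet hs hx⟩, hx, (hg x _).symm⟩
    · rintro ⟨x, hx, rfl⟩
      exact ⟨x, hx, hg x x.2⟩
  have hgs : ∀ s ∈ K.faces, s.image g ∈ L.faces := fun s hs => (he _).2 ⟨s, hs, himg s hs⟩
  have hsurj : ∀ t ∈ L.faces, ∃ s ∈ K.faces, s.image g = t := fun t ht => by
    obtain ⟨s, hs, hts⟩ := (he t).1 ht
    exact ⟨s, hs, by rw [← Finset.coe_inj, himg s hs, hts]⟩
  -- the simplexwise affine extension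
  set f : W → V := plMap K g with hf_def
  have hfimg : ∀ s ∈ K.faces, f '' convexHull ℝ (s : Set W) = convexHull ℝ ((s.image g : Finset V) : Set V) :=
    fun s hs => by
      obtain ⟨A, hfA, hAg⟩ := exists_affineMap_eqOn_plMap (K := K) (g := g) hs
      rw [hfA.image_eq, AffineMap.image_convexHull, Finset.coe_image]
      congr 1
      exact Set.image_congr fun v hv => hAg v hv
  have hfinj : ∀ s ∈ K.faces, InjOn f (convexHull ℝ (s : Set W)) := fun s hs => by
    obtain ⟨A, hfA, hAg⟩ := exists_affineMap_eqOn_plMap (K := K) (g := g) hs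
    have hind : AffineIndependent ℝ (fun v : s => A v) := by
      let emb : s ↪ (s.image g : Finset V) :=
        ⟨fun v => ⟨g v, Finset.mem_image_of_mem g v.2⟩, fun v w hvw => Subtype.ext
          (hgi (Faces.subset_vertexSet hs v.2) (Faces.subset_vertexSet hs w.2) (congrArg Subtype.val hvw))⟩
      have h1 : AffineIndependent ℝ (fun v : s => g (v : W)) := (L.indep (hgs s hs)).comp_embedding emb
      have h2 : (fun v : s => A v) = fun v : s => g (v : W) := funext fun v => hAg v v.2
      rw [h2]
      exact h1
    -- `A` is injective on the affine span of `s`, and `f = A` on the closed simplex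
    intro x hx y hy hxy
    have hA := injOn_affineSpan_of_affineIndependent A hind
    have hxy' : A x = A y := by rw [← hfA hx, ← hfA hy]; exact hxy
    exact hA (convexHull_subset_affineSpan (s : Set W) hx) (convexHull_subset_affineSpan (s : Set W) hy) hxy'
  -- bijectivity on the polyhedra
  have hmaps : MapsTo f K.space L.space := fun x hx => by
    obtain ⟨s, hs, hxs⟩ := Geometry.SimplicialComplex.mem_space_iff.1 hx
    have : f x ∈ f '' convexHull ℝ (s : Set W) := ⟨x, hxs, rfl⟩
    rw [hfimg s hs] at this
    exact L.convexHull_subset_space (hgs s hs) this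
  have hsurjOn : SurjOn f K.space L.space := fun y hy => by
    obtain ⟨t, ht, hyt⟩ := Geometry.SimplicialComplex.mem_space_iff.1 hy
    obtain ⟨s, hs, rfl⟩ := hsurj t ht
    rw [← hfimg s hs] at hyt
    obtain ⟨x, hxs, rfl⟩ := hyt
    exact ⟨x, K.convexHull_subset_space hs hxs, rfl⟩
  have hinjOn : InjOn f K.space := fun x hx y hy hxy => by
    obtain ⟨s, hs, hxs⟩ := Geometry.SimplicialComplex.mem_space_iff.1 hx
    obtain ⟨t, ht, hyt⟩ := Geometry.SimplicialComplex.mem_space_iff.1 hy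
    -- `f x = f y` lies in the closed simplex of `(s ∩ t).image g`
    have hz : f x ∈ convexHull ℝ (((s ∩ t).image g : Finset V) : Set V) := by
      have h1 : f x ∈ convexHull ℝ ((s.image g : Finset V) : Set V) := by
        rw [← hfimg s hs]; exact ⟨x, hxs, rfl⟩
      have h2 : f x ∈ convexHull ℝ ((t.image g : Finset V) : Set V) := by
        rw [hxy, ← hfimg t ht]; exact ⟨y, hyt, rfl⟩
      have h12 := L.inter_subset_convexHull (hgs s hs) (hgs t ht) ⟨h1, h2⟩
      rw [← Finset.coe_inter, ← Finset.image_inter_of_injOn] at h12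
      · exact h12
      · exact hgi.mono (Set.union_subset (Faces.subset_vertexSet hs) (Faces.subset_vertexSet ht))
    have hne : (s ∩ t).Nonempty := by
      by_contra h0
      rw [Finset.not_nonempty_iff_eq_empty] at h0
      rw [h0, Finset.image_empty, Finset.coe_empty, convexHull_empty] at hz
      exact hz
    have hst : s ∩ t ∈ K.faces := K.down_closed hs Finset.inter_subset_left hne
    rw [← hfimg _ hst] at hz
    obtain ⟨x', hx', hxx'⟩ := hz
    -- `x = x'` by injectivity on `s`, so `x` lies in the simplex of `t` as well
    have hx'S : x' ∈ convexHull ℝ (s : Set W) :=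
      convexHull_mono (by simp) hx'
    have hx't : x' ∈ convexHull ℝ (t : Set W) :=
      convexHull_mono (by simp) hx'
    have hxx : x = x' := (hfinj s hs hxs hx'S hxx'.symm)
    subst hxx
    exact hfinj t ht hx't hyt hxy
  have hbij : BijOn f K.space L.space := ⟨hmaps, hinjOn, hsurjOn⟩
  have hcont : ContinuousOn f K.space := continuousOn_plMap hK g
  haveI : CompactSpace K.space := isCompact_iff_compactSpace.1 (isCompact_space_of_finite hK)
  have hc : Continuous (hbij.equiv f) := hcont.mapsToRestrict hmaps
  refine ⟨f, fun s hs => ?_, hc.homeoOfEquivCompactToT2, fun x => rfl⟩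
  obtain ⟨A, hfA, -⟩ := exists_affineMap_eqOn_plMap (K := K) (g := g) hs
  exact ⟨A, hfA⟩

/-- **PL homeomorphic finite complexes have homeomorphic polyhedra** (indeed, by a homeomorphism
affine on every simplex of a finite subdivision): the topological content of `PLHomeomorphicCx`
for complexes in finite-dimensional real normed spaces. [folklore] -/
theorem PLHomeomorphicCx.nonempty_homeomorph {K : Geometry.SimplicialComplex ℝ W}
    {L : Geometry.SimplicialComplex ℝ V} (h : PLHomeomorphicCx K L) : Nonempty (K.space ≃ₜ L.space) := by
  obtain ⟨K', L', hK', -, hKK', hLL', hiso⟩ := h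
  obtain ⟨f, -, e, -⟩ := Faces.Isomorphic.exists_homeomorph_affine hK' hiso
  exact ⟨(Homeomorph.setCongr hKK'.space_eq.symm).trans (e.trans (Homeomorph.setCongr hLL'.space_eq))⟩

end IsoHomeo

/-! ### The classical theorems (named facts) -/

universe u v

/-- **Alexander–Newman; Lickorish, Theorem 4.5 — PL homeomorphic ⟺ stellar equivalent.**
*"Two `n`-dimensional simplicial complexes are piecewise linearly homeomorphic if and only if
they are stellar equivalent"*; equivalently (the abstract of the paper) *any subdivision of a finite
simplicial complex is obtained from it by a finite sequence of stellar moves* (and isomorphisms).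
Typed for finite geometric complexes `K ⊆ E`, `L ⊆ E'` over `ℝ` (a finite complex spans a
finite-dimensional subspace, Lickorish's "contained in some `ℝᴺ`"): `PLHomeomorphicCx K L ↔
Faces.StellarEquivalent K.faces L.faces` (all stellar moves performed on vertices of `E`, which is
infinite as soon as it is nonzero; for `E = 0` both sides say that `L` is empty or a single
vertex).  Datta (2007), Thm. 4.13.  Named fact, not proved here
(classical: slicing by hyperplanes, starrability of stellar balls, Thm. 3.6–3.9 of the source).
[cite: Lickorish1999, Thm. 4.5] -/
def Lickorish1999_thm_4_5 : Prop :=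
  ∀ (E : Type u) (E' : Type v) [AddCommGroup E] [Module ℝ E] [DecidableEq E] [AddCommGroup E']
    [Module ℝ E'] (K : Geometry.SimplicialComplex ℝ E) (L : Geometry.SimplicialComplex ℝ E'),
    K.faces.Finite → L.faces.Finite →
      (PLHomeomorphicCx K L ↔ Faces.StellarEquivalent K.faces L.faces)

/-- **A smooth triangulation is a combinatorial manifold** (Munkres 1966, §8, Exercise (a) after
Theorem 8.4: *"Assume the hypotheses of 8.4* [`f : K → M` a `Cʳ` non-degenerate homeomorphism
onto the manifold `M`, i.e. a `Cʳ` triangulation]. *Show that `K` is a combinatorial `n`-manifold.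
This means that for each `k`-simplex `s` of `K`, the link of `s`, `Lk s = cl(St s) - St s`, is a
combinatorial `(n-k-1)`-sphere; that is, it has a subdivision isomorphic with a subdivision of the
boundary of an `(n-k)`-simplex"*; J. H. C. Whitehead 1940).  Typed for a Whitehead smooth
triangulation `h : |K| ≃ₜ M` of a boundaryless `C^∞` `n`-manifold by a finite Euclidean complex
(`IsSmoothTriangulation n K h`, `SmoothTriangulation.lean`), with "combinatorial sphere" in the
stellar form (equivalent by Lickorish's Thm. 4.5): for every simplex `s` of `K` and `k` with
`s.card + k = n + 1`, the link `lk(s, K)` is stellar equivalent to `∂Δᵏ` (on `Fin (k + 1)`).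
Named fact. [cite: Munkres1966, §8 Exercise (a) after Thm. 8.4] -/
def Munkres1966_8_4_links_of_smoothTriangulation : Prop :=
  ∀ (n N : ℕ) (M : Type u) [TopologicalSpace M] [ChartedSpace (EuclideanSpace ℝ (Fin n)) M]
    [IsManifold (𝓡 n) ∞ M] (K : Geometry.SimplicialComplex ℝ (EuclideanSpace ℝ (Fin N)))
    (h : K.space ≃ₜ M), IsSmoothTriangulation n K h →
      ∀ s ∈ K.faces, ∀ k : ℕ, s.card + k = n + 1 →
        Faces.StellarEquivalent (Faces.link K.faces s)
          (simplexBoundary (Finset.univ : Finset (Fin (k + 1)))).faces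

/-- **Corollary: a smoothly triangulated closed manifold is a closed combinatorial manifold** —
every vertex link of a Whitehead smooth triangulation of a boundaryless `C^∞` `n`-manifold is a
combinatorial `(n-1)`-sphere (the case `s = {v}`, `k = n` of
`Munkres1966_8_4_links_of_smoothTriangulation`, taken as the hypothesis `hM`).
[cite: Munkres1966, §8 Exercise (a) after Thm. 8.4] -/
theorem isClosedCombinatorialManifold_of_isSmoothTriangulation
    (hM : Munkres1966_8_4_links_of_smoothTriangulation.{u}) {n N : ℕ} {M : Type u} [TopologicalSpace M]
    [ChartedSpace (EuclideanSpace ℝ (Fin n)) M] [IsManifold (𝓡 n) ∞ M]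
    {K : Geometry.SimplicialComplex ℝ (EuclideanSpace ℝ (Fin N))} {h : K.space ≃ₜ M}
    (hK : IsSmoothTriangulation n K h) : Faces.IsClosedCombinatorialManifold n K.faces := by
  intro v hv
  rw [Faces.mem_vertexSet_iff_singleton_mem K.isRelLowerSet_faces] at hv
  exact hM n N M K h hK {v} hv n (by rw [Finset.card_singleton, Nat.add_comm])

end Literature.Topology.FourManifolds

end
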